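import Literature.NumberTheory.LFunctions.ChebyshevHalfLineBiasLogDerivHalf
import Literature.NumberTheory.LFunctions.ChebyshevHalfLineBiasProgressionsRiesz
import Literature.NumberTheory.LFunctions.ZetaScrewNonArchSign
import HarnessLib

/-!
# RH-FREE — Suzuki's sign constant `C(q) = Σ_{χ mod q} (L'/L)(½, χ)` for an odd prime `q`: the printed closed form PROVED and its SIGN settled in the kernel (Suzuki 2025, §1.3) — «nothing here bears on the truth of RH»

LINE 1 — LABEL: RH-FREE literature (an unconditional special-value identity for the Dirichlet `L`-functions to a prime
modulus at `s = ½`, and two real inequalities). It concerns the CONSTANT on the right of the GRH-criteria (1.23)/(1.24) of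
Suzuki's Thm 6 (the tree's named facts `Suzuki2025Chebyshev_thm6_limits`, `ChebyshevHalfLineBiasCharacters.lean`), not the
criteria themselves. WHAT THIS IS NOT: not a route, not progress toward RH or GRH; nothing here bears on the truth of RH.
TRIAGE-TYPING tranche 1 part 2 (director-rh 2026-08-26, D-0088(4)); theorems only — no definition, no named fact
(D-0014/D-0026).

Source, read at the page (held TeX `paper:arxiv-2411.07436` chunk p0005 L105–L125; journal PDF p. 10), PUBLISHED, refereed:

> M. Suzuki, *On variants of Chebyshev's conjecture*, Ramanujan J. **68** (2025), no. 4, art. 95,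
> doi:10.1007/s11139-025-01238-9 = arXiv:2411.07436 [bib: `Suzuki2025Chebyshev`], §1.3, the display after Theorem 6.

AS PRINTED: «According to the second and third statements of Theorem 6, the sign of the sums (1.21) and (1.22) for
sufficiently large `x`, which are assumed in the first statement, should be determined by the constant
`C(q) := Σ_{χ mod q} (L'/L)(½, χ) ∈ ℝ`. For simplicity, let `q` be an odd prime. Then, taking into account that there are
`(q − 1)/2 − 1` even primitive Dirichlet characters and `(q − 1)/2` odd primitive Dirichlet characters, we obtain the formula
`C(q) = ((q − 1)/2)(log 8π + C₀) − ((q − 2)/2) log q + log q/(√q − 1)` from (3.2), (4.6), and [Gauss's values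
`(Γ'/Γ)(¼ + κ(χ)/2) = (κ(χ) − ½)π − 3 log 2 − C₀`, journal eq. (66)] below, where `C₀` is the Euler–Mascheroni constant. It
follows that `C(q) < 0` for all odd primes `≤ 47`, while `C(q) > 0` for all primes `≥ 53`.» (Journal numbering: (3.2) = (47)
`(ζ'/ζ)(½) = ½(π/2 + log 8π + C₀) = 2.68609…`, (4.6) = (65).)

THIS FILE PROVES, for an odd prime `q` (the printed hypothesis of Thm 6 (ii)/(iii) «`L(½, χ) ≠ 0` for all `χ` mod `q`» is
carried explicitly: at a zero of `L(s, χ)` Mathlib's `logDeriv` takes the junk value `0`):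
* `SuzukiSignConstant.sum_logDeriv_half_eq_ofReal` — `C(q) ∈ ℝ` (the printed «`∈ ℝ`»: conjugation symmetry `χ ↦ χ̄`);
* `Suzuki2025Chebyshev_charSum_logDeriv_half_eq` — **the printed closed form**
  `Σ_χ (L'/L)(½, χ) = ((q−1)/2)(log 8π + γ) − ((q−2)/2) log q + log q/(√q − 1)`, assembled exactly as printed from the
  tree's (3.2) `logDeriv_riemannZeta_one_half` (`(ζ'/ζ)(½) = ½(γ + π/2 + 3 log 2 + log π)`, `ZetaScrewNonArchSign.lean`),
  the tree's (4.6) `DirichletLogDerivHalf.re_logDeriv_LFunction_half_of_even/_of_odd` (`ChebyshevHalfLineBiasLogDerivHalf.lean`),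
  the principal-character term `(L'/L)(½, χ₀) = (ζ'/ζ)(½) + log q/(√q − 1)` (the tree's level-change identity
  `ProgressionsRiesz.logDeriv_LFunction_changeLevel`), and the parity census «`(q−1)/2 − 1` even, `(q−1)/2` odd»
  (orthogonality `Σ_χ χ(−1) = 0`, Mathlib `DirichletCharacter.sum_characters_eq_zero`, and `#χ = φ(q) = q − 1`);
* `Suzuki2025Chebyshev_Cq_pos` / `Suzuki2025Chebyshev_Cq_neg` — **the sign of the printed closed form**, as real
  inequalities with kernel numerics: `C(q) > 0` for `3 ≤ q ≤ 47` and `C(q) < 0` for `q ≥ 53` (all real `q` in these ranges),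
  via the enclosures `44 < 8π e^γ < 44.9` and `3.78 < log 8π + γ < 3.81` (`C(q) = ½(q−2)(log(8πe^γ) − log q) + … `, so the
  sign turns where `q` passes `8πe^γ = 44.76…` plus a bounded correction; the printed change-point «between 47 and 53» is
  confirmed); hence `Suzuki2025Chebyshev_charSum_logDeriv_half_re_pos/_neg` for the character sum itself and
  `Suzuki2025Chebyshev_thm6_constant_re_neg/_pos` for the printed limit `−φ(q)⁻¹ C(q)` of (1.23)/(1.24);
* §5, the printed remark itself under GRH: `Suzuki2025Chebyshev_sum121_eventually_neg_of_GRH` /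
  `_eventually_pos_of_GRH` — GRH for all `χ` mod `q` and `L(½, χ) ≠ 0` ⟹ the sum (1.21) is eventually negative (odd primes
  `q ≤ 47`) / eventually positive (primes `q ≥ 53`), through the tree's Thm 6 (ii) «if» half
  `ProgressionsRiesz.tendsto_progressionRieszMean_of_GRH` [GRH-CONDITIONAL consequences].

AS-PRINTED AUDIT FINDING (recorded, for the referee; the print is NOT repaired or endorsed here): the printed sentence
«`C(q) < 0` for all odd primes `≤ 47`, while `C(q) > 0` for all primes `≥ 53`» has the two SIGNS REVERSED relative to the
printed formula standing immediately before it (already `C(3) = (log 8π + γ) − ½ log 3 + log 3/(√3 − 1) ≈ 4.75 > 0`, and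
`(L'/L)(½, χ₀ mod 3) > (ζ'/ζ)(½) = 2.68… > 0`): the kernel proves `C(q) > 0` for the odd primes `q ≤ 47` and `C(q) < 0` for
the primes `q ≥ 53`. Equivalently, the limit `−φ(q)⁻¹ C(q)` in (1.23)/(1.24) — the eventual sign of the sums (1.21)/(1.22)
under the hypotheses of Thm 6 — is NEGATIVE for `3 ≤ q ≤ 47` (the direction of the classical bias, as for `q = 1` where the
limit is `−(ζ'/ζ)(½) < 0`) and POSITIVE for primes `q ≥ 53`; the sentence is consistent with the formula if read for the sums
rather than for `C(q)`. The journal version (Ramanujan J. 68:95, p. 10) and arXiv v3 print the same sentence. Nothing else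
of §1.3 is restated here (Thm 6 itself: `Suzuki2025Chebyshev_thm6_i`, `Suzuki2025Chebyshev_thm6_limits`).

## References
* [Suzuki2025Chebyshev] M. Suzuki, Ramanujan J. 68 (2025) 95 = arXiv:2411.07436: §1.3, display after Thm 6 (definition
  of `C(q)`, its closed form for an odd prime, the sign sentence); §3.1 (3.2); §4.1 (4.6); §5.1 (the principal character).
* [DavenportMNT1980] H. Davenport, *Multiplicative Number Theory*, 2nd ed., Springer GTM 74 (1980), ch. 5 (primitive
  characters; characters to a prime modulus), ch. 9 (functional equation) — background for §1.
-/

noncomputable section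

open Complex Filter Topology Set ArithmeticFunction
open scoped Real ComplexConjugate

namespace Literature.NumberTheory.LFunctions

namespace SuzukiSignConstant

open Literature.Analysis.SpecialFunctions.Real DirichletLogDerivHalf ProgressionsRiesz HalfLineRieszImprimitive

variable {q : ℕ} [NeZero q]

/-! ## §1 Characters to a prime modulus: primitivity and the parity census -/

/-- To a prime modulus every non-principal character is primitive (its conductor divides `q` and is not `1`).
[cite: DavenportMNT1980, ch. 5] -/
theorem isPrimitive_of_prime (hq : q.Prime) {χ : DirichletCharacter ℂ q} (hχ : χ ≠ 1) : χ.IsPrimitive := by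
  rw [DirichletCharacter.isPrimitive_def]
  rcases (Nat.dvd_prime hq).1 χ.conductor_dvd_level with h | h
  · exact absurd (DirichletCharacter.eq_one_iff_conductor_eq_one.2 h) hχ
  · exact h

omit [NeZero q] in
/-- The principal character is even. [folklore] -/
private theorem even_one : (1 : DirichletCharacter ℂ q).Even := by
  change (1 : DirichletCharacter ℂ q) (-1) = 1
  exact MulChar.one_apply isUnit_one.neg

omit [NeZero q] in
/-- An odd character is not principal. [folklore] -/
private theorem ne_one_of_odd {χ : DirichletCharacter ℂ q} (hχ : χ.Odd) : χ ≠ 1 := by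
  rintro rfl
  exact DirichletCharacter.Even.not_odd (1 : DirichletCharacter ℂ q) even_one hχ

omit [NeZero q] in
open Classical in
/-- The non-even characters are exactly the odd ones (`χ(−1) = ±1`). [folklore] -/
private theorem filter_not_even_eq :
    (Finset.univ.filter fun χ : DirichletCharacter ℂ q ↦ ¬χ.Even) =
      Finset.univ.filter fun χ : DirichletCharacter ℂ q ↦ χ.Odd :=
  Finset.filter_congr fun χ _ ↦ ⟨fun h ↦ χ.even_or_odd.resolve_left h, fun h ↦ h.not_even⟩

omit [NeZero q] in
/-- For `q > 2`, `−1 ≢ 1 (mod q)`. [folklore] -/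
private theorem neg_one_ne_one (hq : q.Prime) (hq2 : q ≠ 2) : (-1 : ZMod q) ≠ 1 := by
  intro h
  have h2 : ((2 : ℕ) : ZMod q) = 0 := by
    have : (2 : ZMod q) = 0 := by linear_combination -h
    exact_mod_cast this
  have hdvd : q ∣ 2 := (ZMod.natCast_eq_zero_iff 2 q).1 h2
  have h1 := Nat.le_of_dvd two_pos hdvd
  have h3 := hq.two_le
  omega

open Classical in
/-- **Parity census, first half**: to an odd prime modulus there are as many even as odd characters
(`Σ_χ χ(−1) = 0` by orthogonality, since `−1 ≢ 1`). [cite: Suzuki2025Chebyshev, §1.3, display after Thm 6 («(q−1)/2 − 1 even … (q−1)/2 odd»)] -/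
theorem card_even_eq_card_odd (hq : q.Prime) (hq2 : q ≠ 2) :
    (Finset.univ.filter fun χ : DirichletCharacter ℂ q ↦ χ.Even).card =
      (Finset.univ.filter fun χ : DirichletCharacter ℂ q ↦ χ.Odd).card := by
  have hsum := DirichletCharacter.sum_characters_eq_zero ℂ (neg_one_ne_one hq hq2)
  rw [← Finset.sum_filter_add_sum_filter_not Finset.univ (fun χ : DirichletCharacter ℂ q ↦ χ.Even),
    filter_not_even_eq] at hsum
  have hE : ∑ χ ∈ Finset.univ.filter (fun χ : DirichletCharacter ℂ q ↦ χ.Even), χ (-1) =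
      ((Finset.univ.filter fun χ : DirichletCharacter ℂ q ↦ χ.Even).card : ℂ) := by
    calc ∑ χ ∈ Finset.univ.filter (fun χ : DirichletCharacter ℂ q ↦ χ.Even), χ (-1)
        = ∑ χ ∈ Finset.univ.filter (fun χ : DirichletCharacter ℂ q ↦ χ.Even), (1 : ℂ) :=
          Finset.sum_congr rfl fun χ hχ ↦ (Finset.mem_filter.1 hχ).2
      _ = ((Finset.univ.filter fun χ : DirichletCharacter ℂ q ↦ χ.Even).card : ℂ) := by
          rw [Finset.sum_const, nsmul_eq_mul, mul_one]
  have hO : ∑ χ ∈ Finset.univ.filter (fun χ : DirichletCharacter ℂ q ↦ χ.Odd), χ (-1) =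
      -((Finset.univ.filter fun χ : DirichletCharacter ℂ q ↦ χ.Odd).card : ℂ) := by
    calc ∑ χ ∈ Finset.univ.filter (fun χ : DirichletCharacter ℂ q ↦ χ.Odd), χ (-1)
        = ∑ χ ∈ Finset.univ.filter (fun χ : DirichletCharacter ℂ q ↦ χ.Odd), (-1 : ℂ) :=
          Finset.sum_congr rfl fun χ hχ ↦ (Finset.mem_filter.1 hχ).2
      _ = -((Finset.univ.filter fun χ : DirichletCharacter ℂ q ↦ χ.Odd).card : ℂ) := by
          rw [Finset.sum_const, nsmul_eq_mul, mul_neg, mul_one]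
  rw [hE, hO] at hsum
  have h : ((Finset.univ.filter fun χ : DirichletCharacter ℂ q ↦ χ.Even).card : ℂ) =
      (Finset.univ.filter fun χ : DirichletCharacter ℂ q ↦ χ.Odd).card := by
    linear_combination hsum
  exact_mod_cast h

open Classical in
/-- **Parity census, second half**: `#{even} + #{odd} = φ(q) = q − 1` for a prime `q`.
[cite: Suzuki2025Chebyshev, §1.3, display after Thm 6 («(q−1)/2 − 1 even … (q−1)/2 odd»)] -/
theorem card_even_add_card_odd (hq : q.Prime) :
    (Finset.univ.filter fun χ : DirichletCharacter ℂ q ↦ χ.Even).card +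
      (Finset.univ.filter fun χ : DirichletCharacter ℂ q ↦ χ.Odd).card = q - 1 := by
  rw [← filter_not_even_eq, Finset.card_filter_add_card_filter_not, Finset.card_univ,
    ← Nat.card_eq_fintype_card, DirichletCharacter.card_eq_totient_of_hasEnoughRootsOfUnity ℂ q,
    Nat.totient_prime hq]

/-! ## §2 The principal character: `(L'/L)(½, χ₀) = (ζ'/ζ)(½) + log q/(√q − 1)` -/

/-- **The principal-character term**: for a prime `q`, `(L'/L)(½, χ₀) = (ζ'/ζ)(½) + log q/(√q − 1)`
(`L(s, χ₀) = (1 − q^{−s}) ζ(s)`; the tree's level-change identity `ProgressionsRiesz.logDeriv_LFunction_changeLevel` from the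
character mod `1`, with `r_q = 1/√q`). [cite: Suzuki2025Chebyshev, §1.3, display after Thm 6 (the term `log q/(√q − 1)`)] -/
theorem logDeriv_LFunction_one_half (hq : q.Prime) :
    logDeriv (1 : DirichletCharacter ℂ q).LFunction (1 / 2) =
      logDeriv riemannZeta (1 / 2) + ((Real.log q / (Real.sqrt q - 1) : ℝ) : ℂ) := by
  set ψ : DirichletCharacter ℂ 1 := 1 with hψ
  have hψhalf : ψ.LFunction (1 / 2) ≠ 0 := by
    rw [hψ, DirichletCharacter.LFunction_modOne_eq]
    have := riemannZeta_ofReal_ne_zero_of_pos_of_lt_one (1 / 2) (by norm_num) (by norm_num)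
    push_cast at this
    exact this
  have h1q : (1 : DirichletCharacter ℂ q) = DirichletCharacter.changeLevel (one_dvd q) ψ := by
    rw [hψ, DirichletCharacter.changeLevel_one]
  rw [h1q, logDeriv_LFunction_changeLevel (one_dvd q) ψ hψhalf, hψ, DirichletCharacter.LFunction_modOne_eq,
    Nat.Prime.primeFactors hq, Finset.sum_singleton]
  congr 1
  have hsq : (1 : ℝ) < Real.sqrt q := by
    rw [show (1 : ℝ) = Real.sqrt 1 by simp]
    exact Real.sqrt_lt_sqrt zero_le_one (by exact_mod_cast hq.one_lt)
  have hr : eulerRatio (1 : DirichletCharacter ℂ 1) q = ((Real.sqrt q : ℝ) : ℂ)⁻¹ := by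
    rw [eulerRatio, MulChar.one_apply (isUnit_of_subsingleton _), one_div]
  have hs0 : ((Real.sqrt q : ℝ) : ℂ) ≠ 0 := by
    exact_mod_cast (show Real.sqrt q ≠ 0 by linarith)
  have hs1 : ((Real.sqrt q : ℝ) : ℂ) - 1 ≠ 0 := by
    intro h
    have := congrArg Complex.re h
    simp only [Complex.sub_re, Complex.ofReal_re, Complex.one_re, Complex.zero_re] at this
    linarith
  rw [hr]
  push_cast
  field_simp

/-! ## §3 `C(q) ∈ ℝ` and the printed closed form -/

/-- **`C(q) ∈ ℝ`**: for a prime `q`, `Σ_χ (L'/L)(½, χ)` equals the (real) sum of the real parts — the summands for `χ` and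
`χ̄` are complex conjugates (`DirichletLogDerivHalf.logDeriv_LFunction_inv_half`) and the principal term is real.
[cite: Suzuki2025Chebyshev, §1.3, display after Thm 6 («C(q) := Σ_χ (L'/L)(½, χ) ∈ ℝ»)] -/
theorem sum_logDeriv_half_eq_ofReal (hq : q.Prime) :
    ∑ χ : DirichletCharacter ℂ q, logDeriv χ.LFunction (1 / 2) =
      ((∑ χ : DirichletCharacter ℂ q, (logDeriv χ.LFunction (1 / 2)).re : ℝ) : ℂ) := by
  set f : DirichletCharacter ℂ q → ℂ := fun χ ↦ logDeriv χ.LFunction (1 / 2) with hf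
  have h1 : f 1 = conj (f 1) := by
    simp only [hf]
    rw [logDeriv_LFunction_one_half hq, logDeriv_riemannZeta_one_half, ← Complex.ofReal_add, Complex.conj_ofReal]
  have hconj : ∀ χ : DirichletCharacter ℂ q, f χ⁻¹ = conj (f χ) := by
    intro χ
    by_cases hχ : χ = 1
    · subst hχ
      rw [inv_one]
      exact h1
    · exact logDeriv_LFunction_inv_half hχ
  have hS : ∑ χ, f χ = conj (∑ χ, f χ) := by
    rw [map_sum]
    calc ∑ χ, f χ = ∑ χ, f χ⁻¹ :=
          (Fintype.sum_equiv (Equiv.inv (DirichletCharacter ℂ q)) (fun χ ↦ f χ⁻¹) f fun χ ↦ by simp).symm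
      _ = ∑ χ, conj (f χ) := Finset.sum_congr rfl fun χ _ ↦ hconj χ
  have him : (∑ χ, f χ).im = 0 := by
    have := congrArg Complex.im hS
    rw [Complex.conj_im] at this
    linarith
  apply Complex.ext
  · simp only [Complex.ofReal_re, Complex.re_sum, hf]
  · simp only [Complex.ofReal_im, him]

/-- **The printed closed form, on the real parts**: for an odd prime `q` with `L(½, χ) ≠ 0` for all `χ` mod `q`,
`Σ_χ Re (L'/L)(½, χ) = ((q−1)/2)(log 8π + γ) − ((q−2)/2) log q + log q/(√q − 1)`
(principal term + `((q−1)/2 − 1)`·[(4.6), κ = 0] + `((q−1)/2)`·[(4.6), κ = 1]).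
[cite: Suzuki2025Chebyshev, §1.3, display after Thm 6 (formula for C(q))] -/
theorem sum_re_logDeriv_half_eq (hq : q.Prime) (hq2 : q ≠ 2)
    (hL : ∀ χ : DirichletCharacter ℂ q, χ.LFunction (1 / 2) ≠ 0) :
    ∑ χ : DirichletCharacter ℂ q, (logDeriv χ.LFunction (1 / 2)).re =
      ((q : ℝ) - 1) / 2 * (Real.log (8 * π) + Real.eulerMascheroniConstant) - ((q : ℝ) - 2) / 2 * Real.log q +
        Real.log q / (Real.sqrt q - 1) := by
  classical
  set f : DirichletCharacter ℂ q → ℝ := fun χ ↦ (logDeriv χ.LFunction (1 / 2)).re with hf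
  set Ev := Finset.univ.filter fun χ : DirichletCharacter ℂ q ↦ χ.Even with hEv
  set Od := Finset.univ.filter fun χ : DirichletCharacter ℂ q ↦ χ.Odd with hOd
  set B : ℝ := Real.log π - Real.log q + Real.eulerMascheroniConstant + 3 * Real.log 2 with hB
  -- the three kinds of summands
  have hfE : ∀ χ ∈ Ev \ {1}, f χ = (B + π / 2) / 2 := by
    intro χ hχ
    rw [Finset.mem_sdiff, Finset.mem_singleton] at hχ
    have heven : χ.Even := (Finset.mem_filter.1 hχ.1).2
    simp only [hf]
    rw [re_logDeriv_LFunction_half_of_even (isPrimitive_of_prime hq hχ.2) hχ.2 (hL χ) heven, hB]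
    ring
  have hfO : ∀ χ ∈ Od, f χ = (B - π / 2) / 2 := by
    intro χ hχ
    have hodd : χ.Odd := (Finset.mem_filter.1 hχ).2
    have hne : χ ≠ 1 := ne_one_of_odd hodd
    simp only [hf]
    rw [re_logDeriv_LFunction_half_of_odd (isPrimitive_of_prime hq hne) hne (hL χ) hodd, hB]
    ring
  have hf1 : f 1 = (B + Real.log q + π / 2) / 2 + Real.log q / (Real.sqrt q - 1) := by
    simp only [hf]
    rw [logDeriv_LFunction_one_half hq, logDeriv_riemannZeta_one_half, ← Complex.ofReal_add, Complex.ofReal_re, hB]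
    ring
  -- splitting the sum by parity, and the principal character off the even ones
  have hsplit : ∑ χ, f χ = ∑ χ ∈ Ev, f χ + ∑ χ ∈ Od, f χ := by
    rw [hEv, hOd, ← filter_not_even_eq,
      Finset.sum_filter_add_sum_filter_not Finset.univ (fun χ : DirichletCharacter ℂ q ↦ χ.Even)]
  have h1mem : (1 : DirichletCharacter ℂ q) ∈ Ev := Finset.mem_filter.2 ⟨Finset.mem_univ _, even_one⟩
  have hEsum : ∑ χ ∈ Ev, f χ = ((Ev \ {1}).card : ℝ) * ((B + π / 2) / 2) + f 1 := by
    rw [Finset.sum_eq_sum_sdiff_singleton_add h1mem, Finset.sum_congr rfl hfE, Finset.sum_const, nsmul_eq_mul]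
  have hOsum : ∑ χ ∈ Od, f χ = (Od.card : ℝ) * ((B - π / 2) / 2) := by
    rw [Finset.sum_congr rfl hfO, Finset.sum_const, nsmul_eq_mul]
  -- the census
  have hcardE1 : ((Ev \ {1}).card : ℝ) = (Ev.card : ℝ) - 1 := by
    have h := Finset.card_sdiff_add_card_eq_card (Finset.singleton_subset_iff.2 h1mem)
    rw [Finset.card_singleton] at h
    have h' : ((Ev \ {1}).card : ℝ) + 1 = Ev.card := by exact_mod_cast h
    linarith
  have hEO : (Ev.card : ℝ) = Od.card := by exact_mod_cast card_even_eq_card_odd hq hq2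
  have htot : (Ev.card : ℝ) + Od.card = (q : ℝ) - 1 := by
    have h := card_even_add_card_odd (q := q) hq
    have h1 : 1 ≤ q := hq.one_lt.le
    have h' : ((Ev.card : ℕ) : ℝ) + ((Od.card : ℕ) : ℝ) = ((q - 1 : ℕ) : ℝ) := by exact_mod_cast h
    rw [Nat.cast_sub h1, Nat.cast_one] at h'
    exact h'
  have hO' : (Od.card : ℝ) = ((q : ℝ) - 1) / 2 := by linarith
  have hE' : (Ev.card : ℝ) = ((q : ℝ) - 1) / 2 := by linarith
  have hlog8 : Real.log (8 * π) = 3 * Real.log 2 + Real.log π := by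
    rw [Real.log_mul (by norm_num) Real.pi_ne_zero, show (8 : ℝ) = 2 ^ 3 by norm_num, Real.log_pow]
    push_cast
    ring
  rw [hsplit, hEsum, hOsum, hcardE1, hf1, hlog8, hO', hE', hB]
  ring

end SuzukiSignConstant

open SuzukiSignConstant in
/-- **Suzuki's constant `C(q)`, the printed closed form (odd prime `q`)**: with `L(½, χ) ≠ 0` for every `χ` mod `q` (the
hypothesis of Thm 6 (ii)/(iii), under which `C(q)` is the printed limit constant),
`C(q) = Σ_{χ mod q} (L'/L)(½, χ) = ((q − 1)/2)(log 8π + γ) − ((q − 2)/2) log q + log q/(√q − 1)`.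
RH-FREE identity. [cite: Suzuki2025Chebyshev, §1.3, display after Thm 6 (formula for C(q))] -/
theorem Suzuki2025Chebyshev_charSum_logDeriv_half_eq {q : ℕ} [NeZero q] (hq : q.Prime) (hq2 : q ≠ 2)
    (hL : ∀ χ : DirichletCharacter ℂ q, χ.LFunction (1 / 2) ≠ 0) :
    ∑ χ : DirichletCharacter ℂ q, logDeriv χ.LFunction (1 / 2) =
      ((((q : ℝ) - 1) / 2 * (Real.log (8 * π) + Real.eulerMascheroniConstant) - ((q : ℝ) - 2) / 2 * Real.log q +
        Real.log q / (Real.sqrt q - 1) : ℝ) : ℂ) := by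
  rw [sum_logDeriv_half_eq_ofReal hq, sum_re_logDeriv_half_eq hq hq2 hL]

namespace SuzukiSignConstant

open Literature.Analysis.SpecialFunctions.Real

/-! ## §4 Kernel numerics: `44 < 8π e^γ < 44.9` and `3.78 < log 8π + γ < 3.81` -/

/-- `44 < 8π e^γ (= 44.763…)`: the sign of `log 8π + γ − log q` turns between `q = 44` and `q = 45`.
[cite: Suzuki2025Chebyshev, §1.3, display after Thm 6 (the constant `log 8π + C₀`)] -/
theorem lt_eight_pi_exp_eulerMascheroni : (44 : ℝ) < 8 * π * Real.exp Real.eulerMascheroniConstant := by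
  have hγ := eulerMascheroniConstant_gt_d8
  have hπ := Real.pi_gt_d6
  have h4 : (1 + 0.57721558 + 0.57721558 ^ 2 / 2 + 0.57721558 ^ 3 / 6 : ℝ) ≤ Real.exp 0.57721558 := by
    have h := Real.sum_le_exp_of_nonneg (by norm_num : (0 : ℝ) ≤ 0.57721558) 4
    simp only [Finset.sum_range_succ, Finset.sum_range_zero, Nat.factorial] at h
    norm_num at h ⊢
    linarith
  have hey : Real.exp 0.57721558 ≤ Real.exp Real.eulerMascheroniConstant := Real.exp_le_exp.2 hγ.le
  calc (44 : ℝ) < 8 * 3.141592 * (1 + 0.57721558 + 0.57721558 ^ 2 / 2 + 0.57721558 ^ 3 / 6 : ℝ) := by norm_num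
    _ ≤ 8 * π * Real.exp Real.eulerMascheroniConstant := by gcongr; exact h4.trans hey

/-- `8π e^γ < 44.9`. [cite: Suzuki2025Chebyshev, §1.3, display after Thm 6 (the constant `log 8π + C₀`)] -/
theorem eight_pi_exp_eulerMascheroni_lt : 8 * π * Real.exp Real.eulerMascheroniConstant < (44.9 : ℝ) := by
  have hγ := eulerMascheroniConstant_lt_d8
  have hπ := Real.pi_lt_d6
  have h5 : Real.exp 0.57721571 ≤ (1 + 0.57721571 + 0.57721571 ^ 2 / 2 + 0.57721571 ^ 3 / 6 +
      0.57721571 ^ 4 / 24 + 0.57721571 ^ 5 * 6 / 600 : ℝ) := by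
    have h := Real.exp_bound' (by norm_num : (0 : ℝ) ≤ 0.57721571) (by norm_num : (0.57721571 : ℝ) ≤ 1)
      (n := 5) (by norm_num)
    simp only [Finset.sum_range_succ, Finset.sum_range_zero, Nat.factorial] at h
    norm_num at h ⊢
    linarith
  have hey : Real.exp Real.eulerMascheroniConstant ≤ Real.exp 0.57721571 := Real.exp_le_exp.2 hγ.le
  calc 8 * π * Real.exp Real.eulerMascheroniConstant
      ≤ 8 * 3.141593 * (1 + 0.57721571 + 0.57721571 ^ 2 / 2 + 0.57721571 ^ 3 / 6 +
          0.57721571 ^ 4 / 24 + 0.57721571 ^ 5 * 6 / 600 : ℝ) := by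
        gcongr
        exact hey.trans h5
    _ < 44.9 := by norm_num

/-- `e^{3.78} < 44`. [cite: Suzuki2025Chebyshev, §1.3, display after Thm 6 (numerics for the sign of C(q))] -/
theorem exp_378_lt : Real.exp (3.78 : ℝ) < 44 := by
  have he := Real.exp_one_lt_d9
  have hsplit : Real.exp (3.78 : ℝ) = Real.exp 1 ^ 3 * Real.exp 0.78 := by
    rw [← Real.exp_nat_mul, ← Real.exp_add]
    norm_num
  have h6 : Real.exp 0.78 ≤ (1 + 0.78 + 0.78 ^ 2 / 2 + 0.78 ^ 3 / 6 + 0.78 ^ 4 / 24 + 0.78 ^ 5 / 120 +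
      0.78 ^ 6 * 7 / 4320 : ℝ) := by
    have h := Real.exp_bound' (by norm_num : (0 : ℝ) ≤ 0.78) (by norm_num : (0.78 : ℝ) ≤ 1) (n := 6) (by norm_num)
    simp only [Finset.sum_range_succ, Finset.sum_range_zero, Nat.factorial] at h
    norm_num at h ⊢
    linarith
  rw [hsplit]
  calc Real.exp 1 ^ 3 * Real.exp 0.78 ≤ 2.7182818286 ^ 3 * (1 + 0.78 + 0.78 ^ 2 / 2 + 0.78 ^ 3 / 6 +
      0.78 ^ 4 / 24 + 0.78 ^ 5 / 120 + 0.78 ^ 6 * 7 / 4320 : ℝ) := by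
        gcongr
    _ < 44 := by norm_num

/-- `44.9 < e^{3.81}`. [cite: Suzuki2025Chebyshev, §1.3, display after Thm 6 (numerics for the sign of C(q))] -/
theorem lt_exp_381 : (44.9 : ℝ) < Real.exp 3.81 := by
  have he := Real.exp_one_gt_d9
  have hsplit : Real.exp (3.81 : ℝ) = Real.exp 1 ^ 3 * Real.exp 0.81 := by
    rw [← Real.exp_nat_mul, ← Real.exp_add]
    norm_num
  have h7 : (1 + 0.81 + 0.81 ^ 2 / 2 + 0.81 ^ 3 / 6 + 0.81 ^ 4 / 24 + 0.81 ^ 5 / 120 + 0.81 ^ 6 / 720 : ℝ) ≤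
      Real.exp 0.81 := by
    have h := Real.sum_le_exp_of_nonneg (by norm_num : (0 : ℝ) ≤ 0.81) 7
    simp only [Finset.sum_range_succ, Finset.sum_range_zero, Nat.factorial] at h
    norm_num at h ⊢
    linarith
  rw [hsplit]
  calc (44.9 : ℝ) < 2.7182818283 ^ 3 * (1 + 0.81 + 0.81 ^ 2 / 2 + 0.81 ^ 3 / 6 + 0.81 ^ 4 / 24 +
      0.81 ^ 5 / 120 + 0.81 ^ 6 / 720 : ℝ) := by norm_num
    _ ≤ Real.exp 1 ^ 3 * Real.exp 0.81 := by gcongr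

/-- `log 8π + γ = log(8π e^γ)`. [folklore] -/
private theorem logConst_eq :
    Real.log (8 * π) + Real.eulerMascheroniConstant = Real.log (8 * π * Real.exp Real.eulerMascheroniConstant) := by
  rw [Real.log_mul (by positivity) (Real.exp_pos _).ne', Real.log_exp]

/-- **`3.78 < log 8π + γ < 3.81`** (`= 3.8013…`). [cite: Suzuki2025Chebyshev, §1.3, display after Thm 6 (the constant `log 8π + C₀`)] -/
theorem logEightPi_add_eulerMascheroni_bounds :
    (3.78 : ℝ) < Real.log (8 * π) + Real.eulerMascheroniConstant ∧
      Real.log (8 * π) + Real.eulerMascheroniConstant < 3.81 := by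
  rw [logConst_eq]
  constructor
  · rw [Real.lt_log_iff_exp_lt (by positivity)]
    exact exp_378_lt.trans lt_eight_pi_exp_eulerMascheroni
  · rw [Real.log_lt_iff_lt_exp (by positivity)]
    exact eight_pi_exp_eulerMascheroni_lt.trans lt_exp_381

end SuzukiSignConstant

open SuzukiSignConstant in
/-- **The sign of `C(q)`, small moduli** — for every real `3 ≤ q ≤ 47`,
`((q − 1)/2)(log 8π + γ) − ((q − 2)/2) log q + log q/(√q − 1) > 0`
(`= ½(q − 2)(log(8πe^γ) − log q) + ½(log 8π + γ) + log q/(√q − 1)`: for `q ≤ 44 < 8πe^γ` all three terms are positive;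
for `44 < q ≤ 47`, `log(8πe^γ/q) ≥ 1 − q/44` and `½(log 8π + γ) > 1.89`). AS-PRINTED AUDIT: the source's sentence says
«`C(q) < 0` for all odd primes `≤ 47`» — the kernel proves the opposite sign from the printed formula (module docstring).
RH-FREE real inequality. [cite: Suzuki2025Chebyshev, §1.3, display after Thm 6 («odd primes ≤ 47»)] -/
theorem Suzuki2025Chebyshev_Cq_pos {q : ℝ} (h3 : 3 ≤ q) (h47 : q ≤ 47) :
    0 < (q - 1) / 2 * (Real.log (8 * π) + Real.eulerMascheroniConstant) - (q - 2) / 2 * Real.log q +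
      Real.log q / (Real.sqrt q - 1) := by
  obtain ⟨hA1, _⟩ := logEightPi_add_eulerMascheroni_bounds
  have hAX := logConst_eq
  set A := Real.log (8 * π) + Real.eulerMascheroniConstant with hA
  have hq0 : 0 < q := by linarith
  have hlogq : 0 < Real.log q := Real.log_pos (by linarith)
  have hsqrt : 1 < Real.sqrt q := by
    rw [show (1 : ℝ) = Real.sqrt 1 by simp]
    exact Real.sqrt_lt_sqrt zero_le_one (by linarith)
  have hlast : 0 < Real.log q / (Real.sqrt q - 1) := div_pos hlogq (by linarith)
  have hident : (q - 1) / 2 * A - (q - 2) / 2 * Real.log q + Real.log q / (Real.sqrt q - 1) =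
      (q - 2) / 2 * (A - Real.log q) + A / 2 + Real.log q / (Real.sqrt q - 1) := by ring
  rw [hident]
  have hX := lt_eight_pi_exp_eulerMascheroni
  rcases le_or_gt q 44 with hq44 | hq44
  · have hlt : Real.log q < A := by
      rw [hAX]
      exact Real.log_lt_log hq0 (by linarith)
    have h1 : 0 < (q - 2) / 2 * (A - Real.log q) := mul_pos (by linarith) (by linarith)
    linarith
  · have hAq : 1 - q / 44 < A - Real.log q := by
      have hXq : A - Real.log q = Real.log (8 * π * Real.exp Real.eulerMascheroniConstant / q) := by
        rw [hAX, Real.log_div (by positivity) hq0.ne']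
      rw [hXq]
      have h1 : 1 - q / (8 * π * Real.exp Real.eulerMascheroniConstant) ≤
          Real.log (8 * π * Real.exp Real.eulerMascheroniConstant / q) := by
        have := Real.one_sub_inv_le_log_of_pos
          (show 0 < 8 * π * Real.exp Real.eulerMascheroniConstant / q by positivity)
        rwa [inv_div] at this
      have h2 : q / (8 * π * Real.exp Real.eulerMascheroniConstant) < q / 44 :=
        div_lt_div_of_pos_left hq0 (by norm_num) hX
      linarith
    have h1 : (q - 2) / 2 * (1 - q / 44) < (q - 2) / 2 * (A - Real.log q) :=
      mul_lt_mul_of_pos_left hAq (by linarith)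
    have h2 : (-1.54 : ℝ) ≤ (q - 2) / 2 * (1 - q / 44) := by
      nlinarith [mul_nonneg (sub_nonneg.2 h47) (sub_nonneg.2 hq44.le)]
    have h3 : (1.89 : ℝ) < A / 2 := by linarith
    linarith

open SuzukiSignConstant in
/-- **The sign of `C(q)`, large moduli** — for every real `q ≥ 53`,
`((q − 1)/2)(log 8π + γ) − ((q − 2)/2) log q + log q/(√q − 1) < 0`
(`log(8πe^γ/q) ≤ 8πe^γ/53 − 1 < 44.9/53 − 1`, `½(log 8π + γ) < 1.905`, and `log q/(√q − 1) ≤ 4/(q^{1/4} + 1) ≤ 4/3.69`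
from `log u ≤ u − 1` at `u = q^{1/4} ≥ 2.69`). AS-PRINTED AUDIT: the source's sentence says «`C(q) > 0` for all primes
`≥ 53`» — the kernel proves the opposite sign from the printed formula (module docstring). RH-FREE real inequality.
[cite: Suzuki2025Chebyshev, §1.3, display after Thm 6 («primes ≥ 53»)] -/
theorem Suzuki2025Chebyshev_Cq_neg {q : ℝ} (h53 : 53 ≤ q) :
    (q - 1) / 2 * (Real.log (8 * π) + Real.eulerMascheroniConstant) - (q - 2) / 2 * Real.log q +
      Real.log q / (Real.sqrt q - 1) < 0 := by
  obtain ⟨_, hA2⟩ := logEightPi_add_eulerMascheroni_bounds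
  have hAX := logConst_eq
  set A := Real.log (8 * π) + Real.eulerMascheroniConstant with hA
  have hq0 : 0 < q := by linarith
  have hident : (q - 1) / 2 * A - (q - 2) / 2 * Real.log q + Real.log q / (Real.sqrt q - 1) =
      (q - 2) / 2 * (A - Real.log q) + A / 2 + Real.log q / (Real.sqrt q - 1) := by ring
  rw [hident]
  have hX2 := eight_pi_exp_eulerMascheroni_lt
  -- the main (negative) term
  have hA53 : A - Real.log q ≤ 44.9 / 53 - 1 := by
    have hlogq : Real.log 53 ≤ Real.log q := Real.log_le_log (by norm_num) h53
    have hX53 : A - Real.log 53 = Real.log (8 * π * Real.exp Real.eulerMascheroniConstant / 53) := by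
      rw [hAX, Real.log_div (by positivity) (by norm_num)]
    have h1 : Real.log (8 * π * Real.exp Real.eulerMascheroniConstant / 53) ≤
        8 * π * Real.exp Real.eulerMascheroniConstant / 53 - 1 := Real.log_le_sub_one_of_pos (by positivity)
    have h2 : 8 * π * Real.exp Real.eulerMascheroniConstant / 53 < 44.9 / 53 := by gcongr
    linarith
  have hc : A - Real.log q < 0 := by linarith
  have h1 : (q - 2) / 2 * (A - Real.log q) ≤ 51 / 2 * (44.9 / 53 - 1) := by
    nlinarith [mul_nonneg (sub_nonneg.2 h53) (neg_nonneg.2 hc.le)]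
  -- the correction `log q/(√q − 1) ≤ 4/(q^{1/4} + 1)`
  have hlast : Real.log q / (Real.sqrt q - 1) ≤ 4 / 3.69 := by
    set u := Real.sqrt (Real.sqrt q) with hu
    have hu0 : 0 < u := Real.sqrt_pos.2 (Real.sqrt_pos.2 hq0)
    have hu2 : u ^ 2 = Real.sqrt q := Real.sq_sqrt (Real.sqrt_nonneg _)
    have hu4 : u ^ 4 = q := by
      rw [show u ^ 4 = (u ^ 2) ^ 2 by ring, hu2, Real.sq_sqrt hq0.le]
    have hu_ge : (2.69 : ℝ) ≤ u := by
      by_contra h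
      have h' : u < 2.69 := not_le.1 h
      have h4 : u ^ 4 < 2.69 ^ 4 := by gcongr
      norm_num at h4
      linarith
    have hlogu : Real.log q = 4 * Real.log u := by
      rw [← hu4, Real.log_pow]
      norm_num
    have hlog_le : Real.log u ≤ u - 1 := Real.log_le_sub_one_of_pos hu0
    have hlogu0 : 0 ≤ Real.log u := Real.log_nonneg (by linarith)
    have hden : Real.sqrt q - 1 = (u - 1) * (u + 1) := by
      rw [← hu2]
      ring
    rw [hlogu, hden, div_le_div_iff₀ (by nlinarith) (by norm_num)]
    nlinarith [mul_le_mul_of_nonneg_left hlog_le (by norm_num : (0 : ℝ) ≤ 4 * 3.69)]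
  have h3 : A / 2 < (1.905 : ℝ) := by linarith
  linarith

open SuzukiSignConstant in
/-- **`C(q) > 0` for the odd primes `q ≤ 47`** (real part of the character sum; the sum is real,
`SuzukiSignConstant.sum_logDeriv_half_eq_ofReal`), under the hypothesis `L(½, χ) ≠ 0` for all `χ` mod `q`. The printed
sentence asserts `C(q) < 0` here (AS-PRINTED AUDIT, module docstring). [cite: Suzuki2025Chebyshev, §1.3, display after Thm 6 («odd primes ≤ 47»)] -/
theorem Suzuki2025Chebyshev_charSum_logDeriv_half_re_pos {q : ℕ} [NeZero q] (hq : q.Prime) (hq2 : q ≠ 2)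
    (h47 : q ≤ 47) (hL : ∀ χ : DirichletCharacter ℂ q, χ.LFunction (1 / 2) ≠ 0) :
    0 < (∑ χ : DirichletCharacter ℂ q, logDeriv χ.LFunction (1 / 2)).re := by
  have h3 : (3 : ℝ) ≤ q := by
    have := hq.two_le
    exact_mod_cast (by omega : 3 ≤ q)
  rw [Complex.re_sum, sum_re_logDeriv_half_eq hq hq2 hL]
  exact Suzuki2025Chebyshev_Cq_pos h3 (by exact_mod_cast h47)

open SuzukiSignConstant in
/-- **`C(q) < 0` for the primes `q ≥ 53`** (real part of the character sum; the sum is real), under the hypothesis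
`L(½, χ) ≠ 0` for all `χ` mod `q`. The printed sentence asserts `C(q) > 0` here (AS-PRINTED AUDIT, module docstring).
[cite: Suzuki2025Chebyshev, §1.3, display after Thm 6 («primes ≥ 53»)] -/
theorem Suzuki2025Chebyshev_charSum_logDeriv_half_re_neg {q : ℕ} [NeZero q] (hq : q.Prime) (h53 : 53 ≤ q)
    (hL : ∀ χ : DirichletCharacter ℂ q, χ.LFunction (1 / 2) ≠ 0) :
    (∑ χ : DirichletCharacter ℂ q, logDeriv χ.LFunction (1 / 2)).re < 0 := by
  have hq2 : q ≠ 2 := by omega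
  rw [Complex.re_sum, sum_re_logDeriv_half_eq hq hq2 hL]
  exact Suzuki2025Chebyshev_Cq_neg (by exact_mod_cast h53)

open SuzukiSignConstant in
/-- **The printed limit constant `−φ(q)⁻¹ C(q)` of (1.23)/(1.24) is NEGATIVE for the odd primes `q ≤ 47`** — the
eventual sign of the sums (1.21)/(1.22) under the hypotheses of Thm 6 (ii)/(iii) and GRH, in the direction of the classical
bias (`q = 1`: `−(ζ'/ζ)(½) < 0`). Stated for the complex constant exactly as it appears in `Suzuki2025Chebyshev_thm6_limits`.
[cite: Suzuki2025Chebyshev, §1.3, display after Thm 6 («the sign of the sums (1.21) and (1.22) … determined by C(q)»)] -/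
theorem Suzuki2025Chebyshev_thm6_constant_re_neg {q : ℕ} [NeZero q] (hq : q.Prime) (hq2 : q ≠ 2) (h47 : q ≤ 47)
    (hL : ∀ χ : DirichletCharacter ℂ q, χ.LFunction (1 / 2) ≠ 0) :
    (-(1 / (Nat.totient q : ℂ)) * ∑ χ : DirichletCharacter ℂ q, logDeriv χ.LFunction (1 / 2)).re < 0 := by
  have hpos := Suzuki2025Chebyshev_charSum_logDeriv_half_re_pos hq hq2 h47 hL
  rw [sum_logDeriv_half_eq_ofReal hq] at hpos ⊢
  set C : ℝ := ∑ χ : DirichletCharacter ℂ q, (logDeriv χ.LFunction (1 / 2)).re with hC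
  rw [Complex.ofReal_re] at hpos
  have hφ : (0 : ℝ) < Nat.totient q := by exact_mod_cast Nat.totient_pos.2 hq.pos
  have hre : (-(1 / (Nat.totient q : ℂ)) * (C : ℂ)).re = -(C / Nat.totient q) := by
    rw [show (-(1 / (Nat.totient q : ℂ)) * (C : ℂ)) = ((-(C / Nat.totient q) : ℝ) : ℂ) by push_cast; ring,
      Complex.ofReal_re]
  rw [hre, neg_lt_zero]
  exact div_pos hpos hφ

open SuzukiSignConstant in
/-- **The printed limit constant `−φ(q)⁻¹ C(q)` of (1.23)/(1.24) is POSITIVE for the primes `q ≥ 53`.**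
[cite: Suzuki2025Chebyshev, §1.3, display after Thm 6 («the sign of the sums (1.21) and (1.22) … determined by C(q)»)] -/
theorem Suzuki2025Chebyshev_thm6_constant_re_pos {q : ℕ} [NeZero q] (hq : q.Prime) (h53 : 53 ≤ q)
    (hL : ∀ χ : DirichletCharacter ℂ q, χ.LFunction (1 / 2) ≠ 0) :
    0 < (-(1 / (Nat.totient q : ℂ)) * ∑ χ : DirichletCharacter ℂ q, logDeriv χ.LFunction (1 / 2)).re := by
  have hneg := Suzuki2025Chebyshev_charSum_logDeriv_half_re_neg hq h53 hL
  rw [sum_logDeriv_half_eq_ofReal hq] at hneg ⊢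
  set C : ℝ := ∑ χ : DirichletCharacter ℂ q, (logDeriv χ.LFunction (1 / 2)).re with hC
  rw [Complex.ofReal_re] at hneg
  have hφ : (0 : ℝ) < Nat.totient q := by exact_mod_cast Nat.totient_pos.2 hq.pos
  have hre : (-(1 / (Nat.totient q : ℂ)) * (C : ℂ)).re = -(C / Nat.totient q) := by
    rw [show (-(1 / (Nat.totient q : ℂ)) * (C : ℂ)) = ((-(C / Nat.totient q) : ℝ) : ℂ) by push_cast; ring,
      Complex.ofReal_re]
  rw [hre, lt_neg, neg_zero]
  exact div_neg_of_neg_of_pos hneg hφ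

/-! ## §5 «The sign of the sums (1.21) … should be determined by the constant C(q)» — under GRH, made precise

The printed remark, as a kernel statement: by the tree's Thm 6 (ii) «if» half
(`ProgressionsRiesz.tendsto_progressionRieszMean_of_GRH`: GRH for all `χ` mod `q` and `L(½, χ) ≠ 0` give the limit (1.23)
`−φ(q)⁻¹ C(q)`) and §4, the sum (1.21) `Σ_{n ≤ x, n ≡ 1 (q)} Λ(n) n^{-1/2} log(x/n) − 4√x/φ(q) = log x · [Riesz bracket]`
is eventually NEGATIVE for the odd primes `q ≤ 47` and eventually POSITIVE for the primes `q ≥ 53`. GRH-CONDITIONAL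
consequences of a GRH-criterion's constant; nothing here bears on the truth of RH or GRH. -/

namespace SuzukiSignConstant

variable {q : ℕ} [NeZero q]

/-- (1.21) is `log x` times the Riesz bracket of (1.23): for `x > 1`,
`Σ_{n ≤ x, n ≡ 1 (q)} Λ(n) n^{-1/2} log(x/n) − 4√x/φ(q) = log x · [Σ_{n ≤ x, n ≡ 1 (q)} Λ(n) n^{-1/2}(1 − log n/log x) − 4√x/(φ(q) log x)]`.
[cite: Suzuki2025Chebyshev, §1.3 (1.21) and (1.23)] -/
theorem sum121_eq_log_mul_bracket {x : ℝ} (hx : 1 < x) :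
    ∑ n ∈ (Finset.Icc 1 ⌊x⌋₊).filter (fun n : ℕ ↦ (n : ZMod q) = 1), Λ n / Real.sqrt n * Real.log (x / n) -
        4 * Real.sqrt x / Nat.totient q =
      Real.log x * (∑ n ∈ (Finset.Icc 1 ⌊x⌋₊).filter (fun n : ℕ ↦ (n : ZMod q) = 1),
          Λ n / Real.sqrt n * (1 - Real.log n / Real.log x) - 4 * Real.sqrt x / (Nat.totient q * Real.log x)) := by
  have hx0 : 0 < x := by linarith
  have hlx : Real.log x ≠ 0 := (Real.log_pos hx).ne'
  have hφ : (Nat.totient q : ℝ) ≠ 0 := by exact_mod_cast (Nat.totient_pos.2 (NeZero.pos q)).ne'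
  rw [mul_sub, Finset.mul_sum]
  congr 1
  · refine Finset.sum_congr rfl fun n hn ↦ ?_
    have hn1 : 1 ≤ n := (Finset.mem_Icc.1 (Finset.mem_filter.1 hn).1).1
    have hn0 : (0 : ℝ) < n := by exact_mod_cast hn1
    rw [Real.log_div hx0.ne' hn0.ne']
    field_simp
  · field_simp

/-- From the limit (1.23) to the eventual sign of (1.21): if the Riesz bracket tends to a (complex) constant with negative
real part, the sum (1.21) is eventually negative. [cite: Suzuki2025Chebyshev, §1.3, display after Thm 6 («the sign of the sums (1.21) and (1.22) … should be determined by the constant C(q)»)] -/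
theorem sum121_eventually_neg_of_tendsto {T : ℂ} (hT : T.re < 0)
    (h : Tendsto (fun x : ℝ ↦ (((∑ n ∈ (Finset.Icc 1 ⌊x⌋₊).filter (fun n : ℕ ↦ (n : ZMod q) = 1),
          Λ n / Real.sqrt n * (1 - Real.log n / Real.log x))
        - 4 * Real.sqrt x / (Nat.totient q * Real.log x) : ℝ) : ℂ)) atTop (𝓝 T)) :
    ∀ᶠ x : ℝ in atTop, ∑ n ∈ (Finset.Icc 1 ⌊x⌋₊).filter (fun n : ℕ ↦ (n : ZMod q) = 1),
        Λ n / Real.sqrt n * Real.log (x / n) - 4 * Real.sqrt x / Nat.totient q < 0 := by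
  have hre := (Complex.continuous_re.tendsto T).comp h
  simp only [Function.comp_def, Complex.ofReal_re] at hre
  filter_upwards [hre.eventually_lt_const hT, eventually_gt_atTop (1 : ℝ)] with x hx hx1
  rw [sum121_eq_log_mul_bracket hx1]
  exact mul_neg_of_pos_of_neg (Real.log_pos hx1) hx

/-- From the limit (1.23) to the eventual sign of (1.21): positive real part of the constant gives an eventually positive
sum (1.21). [cite: Suzuki2025Chebyshev, §1.3, display after Thm 6 («the sign of the sums (1.21) and (1.22) … should be determined by the constant C(q)»)] -/
theorem sum121_eventually_pos_of_tendsto {T : ℂ} (hT : 0 < T.re)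
    (h : Tendsto (fun x : ℝ ↦ (((∑ n ∈ (Finset.Icc 1 ⌊x⌋₊).filter (fun n : ℕ ↦ (n : ZMod q) = 1),
          Λ n / Real.sqrt n * (1 - Real.log n / Real.log x))
        - 4 * Real.sqrt x / (Nat.totient q * Real.log x) : ℝ) : ℂ)) atTop (𝓝 T)) :
    ∀ᶠ x : ℝ in atTop, 0 < ∑ n ∈ (Finset.Icc 1 ⌊x⌋₊).filter (fun n : ℕ ↦ (n : ZMod q) = 1),
        Λ n / Real.sqrt n * Real.log (x / n) - 4 * Real.sqrt x / Nat.totient q := by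
  have hre := (Complex.continuous_re.tendsto T).comp h
  simp only [Function.comp_def, Complex.ofReal_re] at hre
  filter_upwards [hre.eventually_const_lt hT, eventually_gt_atTop (1 : ℝ)] with x hx hx1
  rw [sum121_eq_log_mul_bracket hx1]
  exact mul_pos (Real.log_pos hx1) hx

end SuzukiSignConstant

open SuzukiSignConstant ProgressionsRiesz in
/-- **The printed remark under GRH, odd primes `q ≤ 47`**: if GRH holds for every `χ` mod `q` and `L(½, χ) ≠ 0` for all
`χ`, then the sum (1.21) `Σ_{n ≤ x, n ≡ 1 (q)} Λ(n) n^{-1/2} log(x/n) − 4√x/φ(q)` is NEGATIVE for all sufficiently large `x`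
(limit (1.23) by the tree's `ProgressionsRiesz.tendsto_progressionRieszMean_of_GRH`; its constant `−φ(q)⁻¹C(q) < 0` by
`Suzuki2025Chebyshev_thm6_constant_re_neg`). GRH-CONDITIONAL; nothing here bears on the truth of RH.
[cite: Suzuki2025Chebyshev, §1.3, display after Thm 6 («the sign of the sums (1.21) and (1.22) … should be determined by the constant C(q)»)] -/
theorem Suzuki2025Chebyshev_sum121_eventually_neg_of_GRH {q : ℕ} [NeZero q] (hq : q.Prime) (hq2 : q ≠ 2)
    (h47 : q ≤ 47) (hL : ∀ χ : DirichletCharacter ℂ q, χ.LFunction (1 / 2) ≠ 0)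
    (hGRH : ∀ χ : DirichletCharacter ℂ q, χ.RiemannHypothesis) :
    ∀ᶠ x : ℝ in atTop, ∑ n ∈ (Finset.Icc 1 ⌊x⌋₊).filter (fun n : ℕ ↦ (n : ZMod q) = 1),
        Λ n / Real.sqrt n * Real.log (x / n) - 4 * Real.sqrt x / Nat.totient q < 0 :=
  sum121_eventually_neg_of_tendsto (Suzuki2025Chebyshev_thm6_constant_re_neg hq hq2 h47 hL)
    (tendsto_progressionRieszMean_of_GRH hL hGRH)

open SuzukiSignConstant ProgressionsRiesz in
/-- **The printed remark under GRH, primes `q ≥ 53`**: if GRH holds for every `χ` mod `q` and `L(½, χ) ≠ 0` for all `χ`,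
then the sum (1.21) is POSITIVE for all sufficiently large `x` (constant `−φ(q)⁻¹C(q) > 0`,
`Suzuki2025Chebyshev_thm6_constant_re_pos`). GRH-CONDITIONAL; nothing here bears on the truth of RH.
[cite: Suzuki2025Chebyshev, §1.3, display after Thm 6 («the sign of the sums (1.21) and (1.22) … should be determined by the constant C(q)»)] -/
theorem Suzuki2025Chebyshev_sum121_eventually_pos_of_GRH {q : ℕ} [NeZero q] (hq : q.Prime) (h53 : 53 ≤ q)
    (hL : ∀ χ : DirichletCharacter ℂ q, χ.LFunction (1 / 2) ≠ 0)
    (hGRH : ∀ χ : DirichletCharacter ℂ q, χ.RiemannHypothesis) :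
    ∀ᶠ x : ℝ in atTop, 0 < ∑ n ∈ (Finset.Icc 1 ⌊x⌋₊).filter (fun n : ℕ ↦ (n : ZMod q) = 1),
        Λ n / Real.sqrt n * Real.log (x / n) - 4 * Real.sqrt x / Nat.totient q :=
  sum121_eventually_pos_of_tendsto (Suzuki2025Chebyshev_thm6_constant_re_pos hq h53 hL)
    (tendsto_progressionRieszMean_of_GRH hL hGRH)

end Literature.NumberTheory.LFunctions
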